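import Summits.FinalStateConjecture.FinalStateConjecture.Theorems.PhotonSphereChannelsWindowedShellChannelsStubFarHalfShareTwoSided
import Summits.FinalStateConjecture.FinalStateConjecture.Theorems.PhotonSphereChannelsWindowedShellChannelsStubLostPSD
import Summits.FinalStateConjecture.FinalStateConjecture.Theorems.PhotonSphereChannelsWindowedShellChannelsStubNearHalfShare
import Summits.FinalStateConjecture.FinalStateConjecture.Theorems.PhotonSphereChannelsCauchyWaveGlobal

/-!
# Crux `WindowedShellChannels` (stmt-FinalStateConjecture-14085), line `Sketch` — stub `stub_farHalfShare`
# (piece P2f of the per-mode line: the far-side large-scale half-share), part 3: the stub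

For one mode `(s, ℓ)`, `s ≤ 2`, `s ≤ ℓ`, of the unit-mass Regge–Wheeler equation along the centred
tortoise line and a time parity `σ` there are `c > 0`, `R₀ > 0`, `B₀ ≥ 0` (namely `c = 1/128`,
`R₀ = R_c(s, ℓ)` of part 2, `B₀ = 0`) such that every finite-energy parity-`σ` solution whose Cauchy
data are supported in `(R₀, ∞)` satisfies `c·E ≤ channelEnergy V 0 (−B₀) ψ atTop`.

Proof.  (1) Density: cut the data off at scale `R` (`Literature.Analysis.Calculus.energy_tail_cutoff_small`:
the tail `((1−χ_R)h, (1−χ_R)g)` has energy `≤ ε` for `R` large), solve the Regge–Wheeler equation with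
the tail data (`CauchyWaveGlobal.stub_rwGlobalCauchy`) and subtract: the remainder has data supported in
`(R₀, 2R)`, so part 2 (`FarHalfShareModel.stub_farHalfShare_compact`) gives it `E_B/16 ≤ F_B⁺ + F_B⁻`;
the far energies and the energies of the three solutions differ by `O(ε)` (parallelogram law for the
energy density, half-line energies bounded by the total energy, conservation), whence
`E/64 ≤ F⁺ + F⁻` for the far energies `F^± = liminf_{t→±∞} ∫⁻_{x>|t|} e[ψ](t)` of `ψ` itself as `ε → 0`.
(2) `F^±` are dominated by the channel energies of aperture `−0` about `0`, and for a parity-pure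
solution the backward channel energy equals the forward one (`NearHalfShare.channelEnergy_atBot_eq_atTop'`),
so `E/128 ≤ ch⁺`.  No definitions. [folklore in method; new]
-/

noncomputable section

set_option linter.dupNamespace false

namespace Summit.FinalStateConjecture.FinalStateConjecture.Theorems.WindowedShellChannelsSketch

open Literature.Geometry.Lorentzian Literature.Geometry.Lorentzian.ReggeWheeler Filter Set MeasureTheory
open Literature.Analysis.PDE Literature.Analysis.Calculus Real
open Summit.FinalStateConjecture.FinalStateConjecture.Theorems.CauchyWaveGlobal
open scoped ENNReal Topology

namespace FarHalfShareModel

variable {V : ℝ → ℝ} {ψ φ : ℝ → ℝ → ℝ}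

/-- The energy density is invariant under `φ ↦ −φ` (written as `(-1)·φ`). [folklore] -/
theorem energyDensity_neg_one_mul (t x : ℝ) :
    energyDensity V (fun t x => (-1) * φ t x) t x = energyDensity V φ t x := by
  unfold energyDensity
  beta_reduce
  rw [deriv_const_mul_field, deriv_const_mul_field]
  ring

/-- The far energies at apex `0` are dominated by the exterior energies of aperture `−0` about `0`.
[folklore] -/
theorem setLIntegral_Ioi_abs_le_exteriorEnergy (t : ℝ) :
    ∫⁻ x in Ioi |t|, ENNReal.ofReal (energyDensity V ψ t x) ≤ exteriorEnergy V 0 (-0) ψ t := by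
  unfold exteriorEnergy
  refine lintegral_mono_set fun x hx => ?_
  have hx' : |t| < x := hx
  have h0 : 0 ≤ |t| := abs_nonneg t
  show -0 + |t| < |x - 0|
  rw [neg_zero, zero_add, sub_zero, abs_of_pos (show (0 : ℝ) < x by linarith)]
  exact hx'

/-- **The parity-free two-sided far estimate for finite-energy far data (one mode)**: with `R_c` from
part 2, every finite-energy solution with data supported in `(R_c, ∞)` has
`E/64 ≤ liminf_{+∞} ∫⁻_{x>|t|} e + liminf_{−∞} ∫⁻_{x>|t|} e` (density argument). [folklore in method; new] -/
theorem far_twoSided {s ℓ : ℕ} (hsℓ : s ≤ ℓ) {Rc : ℝ} (hRc : 3 ≤ Rc)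
    (hcompact : ∀ R₀ B : ℝ, Rc ≤ R₀ → R₀ ≤ B → ∀ ψ : ℝ → ℝ → ℝ,
      IsRWSolution 1 s ℓ (tortoiseRadius one_pos 0) ψ → CauchyDataSupportedOn ψ (Ioo R₀ B) →
        ENNReal.ofReal (1 / 16) * totalEnergy (linePotential 1 s ℓ (tortoiseRadius one_pos 0)) ψ 0
          ≤ liminf (fun t => ∫⁻ x in Ioi |t|, ENNReal.ofReal
              (energyDensity (linePotential 1 s ℓ (tortoiseRadius one_pos 0)) ψ t x)) atTop
            + liminf (fun t => ∫⁻ x in Ioi |t|, ENNReal.ofReal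
              (energyDensity (linePotential 1 s ℓ (tortoiseRadius one_pos 0)) ψ t x)) atBot)
    (hψ : IsRWSolution 1 s ℓ (tortoiseRadius one_pos 0) ψ) (hsupp : CauchyDataSupportedOn ψ (Ioi Rc))
    (hfin : totalEnergy (linePotential 1 s ℓ (tortoiseRadius one_pos 0)) ψ 0 ≠ ⊤) :
    ENNReal.ofReal (1 / 64) * totalEnergy (linePotential 1 s ℓ (tortoiseRadius one_pos 0)) ψ 0
      ≤ liminf (fun t => ∫⁻ x in Ioi |t|, ENNReal.ofReal
          (energyDensity (linePotential 1 s ℓ (tortoiseRadius one_pos 0)) ψ t x)) atTop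
        + liminf (fun t => ∫⁻ x in Ioi |t|, ENNReal.ofReal
          (energyDensity (linePotential 1 s ℓ (tortoiseRadius one_pos 0)) ψ t x)) atBot := by
  set r := tortoiseRadius one_pos (0 : ℝ) with hrdef
  have hr : IsTortoiseRadius 1 r 0 := isTortoiseRadius_tortoiseRadius one_pos 0
  set V := linePotential 1 s ℓ r with hVdef
  have hVd : Differentiable ℝ V := RW.differentiable_linePotential hr s ℓ
  have hV0 : ∀ x, 0 ≤ V x := fun x => (RW.linePotential_pos hr hsℓ x).le
  have hVc : Continuous V := hVd.continuous
  have hC : ContDiff ℝ 2 (Function.uncurry ψ) := hψ.1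
  -- the data
  set h : ℝ → ℝ := ψ 0 with hhdef
  set g : ℝ → ℝ := fun x => deriv (fun τ => ψ τ x) 0 with hgdef
  have hhC : ContDiff ℝ 2 h := hC.comp (contDiff_const.prodMk contDiff_id)
  have hgC : ContDiff ℝ 1 g := contDiff_one_tslice_deriv hC 0
  have hdata0 : ∀ x, x ≤ Rc → h x = 0 ∧ g x = 0 := fun x hx => hsupp x (not_lt.2 hx)
  -- finiteness of the three pieces of the energy on `Ioi 1`
  set E := totalEnergy V ψ 0 with hEdef
  have hElt : E < ⊤ := lt_top_iff_ne_top.2 hfin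
  have hpiece : ∀ f : ℝ → ℝ, Continuous f → (∀ x, 0 ≤ f x) → (∀ x, f x ≤ energyDensity V ψ 0 x) →
      IntegrableOn f (Ioi 1) := by
    intro f hf hf0 hfe
    refine (integrableOn_Ioi_of_lintegral_lt_top hf hf0 (lt_of_le_of_lt ?_ hElt)).1
    exact (setLIntegral_le_lintegral _ _).trans
      (lintegral_mono fun x => ENNReal.ofReal_le_ofReal (hfe x))
  have hh' : Continuous (deriv h) := hhC.continuous_deriv (by norm_num)
  have hE1 : IntegrableOn (fun x => deriv h x ^ 2) (Ioi 1) :=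
    hpiece _ (hh'.pow 2) (fun x => sq_nonneg _) fun x => by
      unfold energyDensity; nlinarith [sq_nonneg (deriv (fun τ => ψ τ x) 0), mul_nonneg (hV0 x) (sq_nonneg (ψ 0 x))]
  have hE2 : IntegrableOn (fun x => V x * h x ^ 2) (Ioi 1) :=
    hpiece _ (hVc.mul (hhC.continuous.pow 2)) (fun x => mul_nonneg (hV0 x) (sq_nonneg _)) fun x => by
      unfold energyDensity; nlinarith [sq_nonneg (deriv (fun τ => ψ τ x) 0), sq_nonneg (deriv (ψ 0) x)]
  have hE3 : IntegrableOn (fun x => g x ^ 2) (Ioi 1) :=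
    hpiece _ (hgC.continuous.pow 2) (fun x => sq_nonneg _) fun x => by
      unfold energyDensity; nlinarith [sq_nonneg (deriv (ψ 0) x), mul_nonneg (hV0 x) (sq_nonneg (ψ 0 x))]
  -- the cutoff
  obtain ⟨χ, hχC, hχ1, hχ2, hχ01, Cχ, -, hCχ⟩ := exists_smooth_cutoff
  -- `E/16 ≤ 4 F + δ` for every `δ > 0`
  set Fp := liminf (fun t => ∫⁻ x in Ioi |t|, ENNReal.ofReal (energyDensity V ψ t x)) atTop with hFp
  set Fm := liminf (fun t => ∫⁻ x in Ioi |t|, ENNReal.ofReal (energyDensity V ψ t x)) atBot with hFm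
  have key : ∀ δ : ℝ, 0 < δ → ENNReal.ofReal (1 / 16) * E ≤ 4 * (Fp + Fm) + ENNReal.ofReal δ := by
    intro δ hδ
    obtain ⟨R₁, hR₁1, hR₁⟩ := energy_tail_cutoff_small (hhC.of_le (by norm_num)) hgC.continuous hVc hV0
      hE1 hE2 hE3 hχC hχ1 hχ2 hχ01 hCχ (ε := δ / 9) (by positivity)
    set R : ℝ := max R₁ Rc with hR
    obtain ⟨hTint, hTsmall⟩ := hR₁ R (le_max_left _ _)
    have hR0 : 0 < R := lt_of_lt_of_le (by linarith) (le_max_right R₁ Rc)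
    -- tail data and the tail solution
    have hTC : ContDiff ℝ 2 fun y => (1 - χ (y / R)) * h y :=
      (contDiff_const.sub ((hχC.of_le (by norm_cast)).comp (contDiff_id.div_const R))).mul hhC
    have hTC1 : ContDiff ℝ 1 fun y => (1 - χ (y / R)) * g y :=
      (contDiff_const.sub ((hχC.of_le (by norm_cast)).comp (contDiff_id.div_const R))).mul hgC
    obtain ⟨ψT, hψT, hT0, hT1⟩ := stub_rwGlobalCauchy 1 r 0 hr s ℓ hsℓ _ _ hTC hTC1
    have hCT : ContDiff ℝ 2 (Function.uncurry ψT) := hψT.1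
    -- the compact piece `ψB = ψ − ψT`
    set ψB : ℝ → ℝ → ℝ := fun t x => 1 * ψ t x + (-1) * ψT t x with hψBdef
    have hψB : IsRWSolution 1 s ℓ r ψB := isSolution_lincomb hψ hψT 1 (-1)
    have hCB : ContDiff ℝ 2 (Function.uncurry ψB) := hψB.1
    have hB0 : ∀ x, ψB 0 x = χ (x / R) * h x := fun x => by
      simp only [hψBdef, hT0]; simp only [hhdef]; ring
    have hB1 : ∀ x, deriv (fun τ => ψB τ x) 0 = χ (x / R) * g x := fun x => by
      simp only [hψBdef]
      rw [deriv_lincomb_fst hC hCT, hT1]; simp only [hgdef]; ring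
    have hBsupp : CauchyDataSupportedOn ψB (Ioo Rc (2 * R)) := by
      intro x hx
      rw [hB0, hB1]
      rcases le_or_gt x Rc with h1 | h1
      · obtain ⟨e1, e2⟩ := hdata0 x h1
        rw [e1, e2, mul_zero]; exact ⟨rfl, rfl⟩
      · have h2 : 2 * R ≤ x := by
          by_contra h3
          exact hx ⟨h1, not_le.1 h3⟩
        have h4 : χ (x / R) = 0 := hχ2 _ (by rw [le_div_iff₀ hR0]; linarith)
        rw [h4, zero_mul, zero_mul]; exact ⟨rfl, rfl⟩
    have hcB := hcompact Rc (2 * R) le_rfl (by linarith [le_max_right R₁ Rc]) ψB hψB hBsupp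
    -- energy of the tail solution
    set ET := totalEnergy V ψT 0 with hETdef
    have hETle : ET ≤ ENNReal.ofReal (δ / 9) := by
      have hT0' : ψT 0 = fun y => (1 - χ (y / R)) * h y := funext hT0
      have hdens : ∀ x, energyDensity V ψT 0 x = deriv (fun y => (1 - χ (y / R)) * h y) x ^ 2
          + V x * ((1 - χ (x / R)) * h x) ^ 2 + ((1 - χ (x / R)) * g x) ^ 2 := by
        intro x
        unfold energyDensity
        rw [hT1 x, hT0', hgdef]
        ring
      have hzero : ∀ x, x < Rc → energyDensity V ψT 0 x = 0 := by
        intro x hx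
        have hloc : (fun y => (1 - χ (y / R)) * h y) =ᶠ[𝓝 x] fun _ => (0 : ℝ) := by
          filter_upwards [Iio_mem_nhds hx] with y hy
          rw [(hdata0 y (le_of_lt hy)).1, mul_zero]
        rw [hdens x, hloc.deriv_eq, (hdata0 x hx.le).1, (hdata0 x hx.le).2]
        simp
      have hsplit : ET = ∫⁻ x in Ioi 1, ENNReal.ofReal (energyDensity V ψT 0 x) := by
        rw [hETdef]; unfold totalEnergy
        rw [← lintegral_add_compl _ measurableSet_Ioi]
        have : ∫⁻ x in (Ioi (1 : ℝ))ᶜ, ENNReal.ofReal (energyDensity V ψT 0 x) = 0 := by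
          refine (setLIntegral_congr_fun measurableSet_Ioi.compl fun x hx => ?_).trans lintegral_zero
          have hx1 : x ≤ 1 := not_lt.1 hx
          rw [hzero x (by linarith), ENNReal.ofReal_zero]
        rw [this, add_zero]
      rw [hsplit, lintegral_congr fun x => by rw [hdens x],
        ← ofReal_integral_eq_lintegral_ofReal hTint (ae_of_all _ fun x => by
          have := hV0 x; positivity)]
      exact ENNReal.ofReal_le_ofReal hTsmall
    -- far energies and energies: `ψB` versus `ψ`
    set ψN : ℝ → ℝ → ℝ := fun t x => (-1) * ψT t x with hψNdef
    have hCN : ContDiff ℝ 2 (Function.uncurry ψN) := contDiff_const.mul hCT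
    have hsumB : (fun t x => ψ t x + ψN t x) = ψB := by
      funext t x; simp only [hψBdef, hψNdef]; ring
    have hsumψ : (fun t x => ψB t x + ψT t x) = ψ := by
      funext t x; simp only [hψBdef]; ring
    have hNfar : ∀ t, ∫⁻ x in Ioi |t|, ENNReal.ofReal (energyDensity V ψN t x) ≤ ET := by
      intro t
      rw [lintegral_congr fun x => by rw [hψNdef, energyDensity_neg_one_mul]]
      exact RW.setLIntegral_Ioi_energy_le_totalEnergy hVd hV0 hψT _ t 0
    have e2 : ENNReal.ofReal (1 + (1 : ℝ)⁻¹) = 2 := by norm_num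
    have e2' : ENNReal.ofReal (1 + (1 : ℝ)) = 2 := by norm_num
    have hfarB : ∀ t, ∫⁻ x in Ioi |t|, ENNReal.ofReal (energyDensity V ψB t x)
        ≤ 2 * (∫⁻ x in Ioi |t|, ENNReal.ofReal (energyDensity V ψ t x)) + 2 * ET := by
      intro t
      have h1 := LostPSD.setLIntegral_energyDensity_add_le hVd hV0 hC hCN one_pos t (Ioi |t|)
      rw [hsumB, e2, e2'] at h1
      refine h1.trans ?_
      gcongr
      exact hNfar t
    have hliminf : ∀ l : Filter ℝ, l.NeBot →
        liminf (fun t => ∫⁻ x in Ioi |t|, ENNReal.ofReal (energyDensity V ψB t x)) l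
          ≤ 2 * liminf (fun t => ∫⁻ x in Ioi |t|, ENNReal.ofReal (energyDensity V ψ t x)) l
            + 2 * ET := by
      intro l hl
      rw [← liminf_const_mul_add _ _ (by simp)]
      exact liminf_le_liminf (Eventually.of_forall hfarB)
    have hEB : E ≤ 2 * totalEnergy V ψB 0 + 2 * ET := by
      have h1 := LostPSD.setLIntegral_energyDensity_add_le hVd hV0 hCB hCT one_pos 0 univ
      rw [hsumψ, e2, e2'] at h1
      simp only [Measure.restrict_univ] at h1
      exact h1
    -- assemble: `E/16 ≤ (2 E_B + 2 E_T)/16`, `E_B/16 ≤ F_B⁺ + F_B⁻ ≤ 2(F⁺ + F⁻) + 4 E_T`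
    have hFB := hcB.trans (add_le_add (hliminf atTop inferInstance) (hliminf atBot inferInstance))
    have h16 : ENNReal.ofReal (1 / 16) * (2 : ℝ≥0∞) = ENNReal.ofReal (1 / 8) := by
      rw [show (2 : ℝ≥0∞) = ENNReal.ofReal 2 by simp, ← ENNReal.ofReal_mul (by norm_num)]; norm_num
    calc ENNReal.ofReal (1 / 16) * E
        ≤ ENNReal.ofReal (1 / 16) * (2 * totalEnergy V ψB 0 + 2 * ET) := by gcongr
      _ = 2 * (ENNReal.ofReal (1 / 16) * totalEnergy V ψB 0) + ENNReal.ofReal (1 / 16) * 2 * ET := by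
          ring
      _ = 2 * (ENNReal.ofReal (1 / 16) * totalEnergy V ψB 0) + ENNReal.ofReal (1 / 8) * ET := by
          rw [h16]
      _ ≤ 2 * (2 * Fp + 2 * ET + (2 * Fm + 2 * ET)) + ENNReal.ofReal (1 / 8) * ET := by gcongr
      _ = 4 * (Fp + Fm) + (8 + ENNReal.ofReal (1 / 8)) * ET := by ring
      _ ≤ 4 * (Fp + Fm) + 9 * ENNReal.ofReal (δ / 9) := by
          gcongr
          · have : ENNReal.ofReal (1 / 8) ≤ 1 := by
              rw [← ENNReal.ofReal_one]; exact ENNReal.ofReal_le_ofReal (by norm_num)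
            calc (8 : ℝ≥0∞) + ENNReal.ofReal (1 / 8) ≤ 8 + 1 := by gcongr
              _ = 9 := by norm_num
      _ = 4 * (Fp + Fm) + ENNReal.ofReal δ := by
          rw [show (9 : ℝ≥0∞) = ENNReal.ofReal 9 by simp, ← ENNReal.ofReal_mul (by norm_num)]
          congr 2; ring
  -- `δ → 0`
  have hmain : ENNReal.ofReal (1 / 16) * E ≤ 4 * (Fp + Fm) := by
    refine ENNReal.le_of_forall_pos_le_add fun ε hε _ => ?_
    rw [← ENNReal.ofReal_coe_nnreal]
    exact key ε (by exact_mod_cast hε)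
  have h4 : (4 : ℝ≥0∞) * (ENNReal.ofReal (1 / 64) * E) = ENNReal.ofReal (1 / 16) * E := by
    rw [← mul_assoc, show (4 : ℝ≥0∞) = ENNReal.ofReal 4 by simp, ← ENNReal.ofReal_mul (by norm_num)]
    norm_num
  rw [← h4] at hmain
  exact (ENNReal.mul_le_mul_iff_right (by norm_num) (by simp)).1 hmain

end FarHalfShareModel

open NearHalfShare FarHalfShareModel in
/-- **Stub `stub_farHalfShare` (piece P2f of the per-mode line of `Sketch`): the far-side large-scale
half-share.**  For one mode `s ≤ 2`, `s ≤ ℓ` and a time parity `σ` there are `c > 0`, `R₀ > 0`, `B₀ ≥ 0`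
(namely `c = 1/128`, `R₀ = R_c(s, ℓ)`, `B₀ = 0`) such that every finite-energy parity-`σ` unit-mass
Regge–Wheeler solution along the centred tortoise line whose Cauchy data are supported in `(R₀, ∞)`
satisfies `c·E ≤ channelEnergy V 0 (−B₀) ψ atTop`.  (Cut regular inverse-square model at apex `0` +
Duhamel transfer + density + time reflection.) [folklore in method; new] -/
theorem stub_farHalfShare (σ : ℝ) (s ℓ : ℕ) (hs : s ≤ 2) (hsℓ : s ≤ ℓ) : ∃ c : ℝ, 0 < c ∧ ∃ R₀ : ℝ, 0 < R₀ ∧ ∃ B₀ : ℝ, 0 ≤ B₀ ∧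
    ∀ ψ : ℝ → ℝ → ℝ, IsRWSolution 1 s ℓ (tortoiseRadius one_pos 0) ψ → (∀ t x, ψ (-t) x = σ * ψ t x) →
      CauchyDataSupportedOn ψ (Ioi R₀) → totalEnergy (linePotential 1 s ℓ (tortoiseRadius one_pos 0)) ψ 0 ≠ ⊤ →
        ENNReal.ofReal c * totalEnergy (linePotential 1 s ℓ (tortoiseRadius one_pos 0)) ψ 0 ≤
          channelEnergy (linePotential 1 s ℓ (tortoiseRadius one_pos 0)) 0 (-B₀) ψ atTop := by
  obtain ⟨Rc, hRc3, hcompact⟩ := stub_farHalfShare_compact s ℓ hs hsℓ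
  refine ⟨1 / 128, by norm_num, Rc, by linarith, 0, le_rfl, ?_⟩
  intro ψ hψ hpar hsupp hfin
  have h2 := far_twoSided hsℓ hRc3 hcompact hψ hsupp hfin
  have hTop : liminf (fun t => ∫⁻ x in Ioi |t|, ENNReal.ofReal
      (energyDensity (linePotential 1 s ℓ (tortoiseRadius one_pos 0)) ψ t x)) atTop
      ≤ channelEnergy (linePotential 1 s ℓ (tortoiseRadius one_pos 0)) 0 (-0) ψ atTop :=
    liminf_le_liminf (Eventually.of_forall fun t => setLIntegral_Ioi_abs_le_exteriorEnergy t)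
  have hBot : liminf (fun t => ∫⁻ x in Ioi |t|, ENNReal.ofReal
      (energyDensity (linePotential 1 s ℓ (tortoiseRadius one_pos 0)) ψ t x)) atBot
      ≤ channelEnergy (linePotential 1 s ℓ (tortoiseRadius one_pos 0)) 0 (-0) ψ atBot :=
    liminf_le_liminf (Eventually.of_forall fun t => setLIntegral_Ioi_abs_le_exteriorEnergy t)
  rw [channelEnergy_atBot_eq_atTop' hpar] at hBot
  have hhalf := half_of_two_sided (h2.trans (add_le_add hTop hBot))
  rw [show (1 / 64 / 2 : ℝ) = 1 / 128 by norm_num] at hhalf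
  exact hhalf

end Summit.FinalStateConjecture.FinalStateConjecture.Theorems.WindowedShellChannelsSketch

end
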